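import Literature.Computability.AlgebraicComplexity.PolynomialKoszulYoungFlatteningMonotone
import Literature.Computability.AlgebraicComplexity.PaddedDeterminant
import HarnessLib
import HarnessLib.Audit

/-!
# Typed cell conjecture C-F-1 / law-level statement S (track F, F-4a): plain Koszul–Young flattenings
# are blind to the padded `3 × 3` permanent against the padded `3 × 3` determinant

Cell `pub-gct-max` (HOME `run/shared/lean/pub/pub-gct-max/`), track F (engine-3, theory-2) typed by track T
(lit-2), PLAN.md §1 lit-2 row (a) "F-4a", lead decisions INBOX 2026-08-22T23:30:42Z and 2026-08-23T00:30:52Z (c).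
Companion prose: `HOME/typed/CHAIN-2.md` §4 and `HOME/typed/AS-PRINTED-2.md` §F. This file ASSERTS NOTHING: it
contains definitions of statements (`def … : Prop`) with their evidence ledgers and PROVED implications between
them. HONEST FRAMING: multiplicity data and certified rank bounds at small parameters; the statements below are
LOCATED NEGATIVES about one family of equations (Koszul–Young flattenings `Λ^p ⊗ S^k`) for the padded `3 × 3`
permanent; occurrence obstructions are ruled out in print (BIP'16) — multiplicity obstructions are the open
door; nothing here is a claim on VP vs VNP or P vs NP.

Letters (PLAN §0): `m = 3` = permanent size, `n` = determinant size, padding by a FRESH variable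
(`X₀₀`, resp. `none`), `KY_{p,k}(P)` = the Koszul–Young flattening `P_{k,d-k}^{∧p} : S^kV^* ⊗ Λ^pV → S^{d-k-1}V ⊗ Λ^{p+1}V`
(Landsberg 2017 (8.2.1); tree `Literature.Computability.AlgebraicComplexity.kyRank`, file
`PolynomialKoszulYoungFlattening.lean`), `rank` over `ℂ`; `paddedPerPoly ℂ 3 n = X₀₀^{n-3}·per₃(block)`,
`paddedDetPoly ℂ 3 n = X₀₀^{n-3}·det₃(block)` (tree, `OrbitClosure.lean`, `PaddedDeterminant.lean`).

## The statements

* `KYBlindPaddedPerThreeOwn` — **C-F-1 as pre-registered and scored** (10 variables): for every `n ≥ 4` and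
  every `(p,k)`, `rank KY_{p,k}(z^{n-3}·perm₃) ≤ rank KY_{p,k}(z^{n-3}·det₃)` in `S^n(ℂ ⊕ ℂ^{3×3})`
  (tree: `ownPaddedPerPoly 3 n`; `ownPaddedDetPoly 3 n` on `Option (Fin 3 × Fin 3)` defined here).
* `KYBlindPaddedPerThree` — **the law-level statement S adopted as the F-4a target** (lead 2026-08-23T00:30:52Z (c),
  theory-2 2026-08-23T00:24:54Z): the same inequality for the two padded cubics VIEWED IN THE `n²` VARIABLES of
  `det_n`.
* `KYPaddedPerThreeClosedForm` — **theory-2's closed form of S (law L6, 2026-08-23T01:50:28Z)**: the EQUALITY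
  `rank KY_{p,k}(X₀₀^{n-3}det₃) = rank KY_{p,k}(X₀₀^{n-3}per₃) + 16·([k=1]·C(n²−10,p−5) + [k=n−2]·C(n²−10,p−4))`;
  `ClosedFormImpliesBlind` + `closedFormImpliesBlind_holds` (PROVED, one line): the closed form implies S.
* `KYCannotSeparatePaddedPerThree` — **the located negative N-F-1 for all `n`** (what S is FOR): for every
  `n ≥ 4` and every `(p,k)`, `rank KY_{p,k}(X₀₀^{n-3}per₃) ≤ rank KY_{p,k}(det_n)` in `S^n(ℂ^{n²})`, i.e. no plain
  Koszul–Young flattening certifies `X₀₀^{n-3}per₃ ∉ \overline{GL_{n²}·det_n}` — a containment that is FALSE for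
  `n = 4, 5, 6` in print (`\underline{dc}(per₃) ≥ 5`: Landsberg–Manivel–Ressayre 2013; `dc(per₃) = 7`:
  Alper–Bogart–Velasco 2017), so for those `n` the flattening family is provably silent where an equation is known
  to exist.
* `BlindImpliesCannotSeparate` + `blindImpliesCannotSeparate_holds` (PROVED, unconditional implication; and
  `ClosedFormImpliesCannotSeparate` + `_holds`): **S ⇒ N-F-1 for all `n`**, because the control
  `X₀₀^{n-3}·det₃(block)` is a linear substitution instance of `det_n` (tree `paddedDetPoly_mem_endOrbit_detPoly`,
  the block-triangular determinant of ELSW's Case C1) and Koszul–Young ranks do not increase under linear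
  substitutions (tree `kyRank_le_of_mem_endOrbit`, `PolynomialKoszulYoungFlatteningMonotone.lean` — the
  `GL(V)`-equivariance of Landsberg's (8.2.1) plus semicontinuity, proved there). The gen-3 draft of this file took
  this monotonicity as a hypothesis `hmono`; it is now a theorem (`kyRank_paddedDetPoly_le_detPoly`).

## Evidence ledger (why these are typed; none of it is used by Lean)

* PRE-REGISTRATION: engine-3, `HOME/pub-gct-max-engine-3/PREDICTIONS-F-1.md` (sha256 `8bcd7d86d988e49b…`, written
  2026-08-22T22:56Z before farm job j175459 returned; referee PREREG-LOG), Conjecture C-F-1: "for all `n ≥ 3` and all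
  `(p,k)`: `rank KY_{p,k}(z^{n−3}perm₃) ≤ rank KY_{p,k}(z^{n−3}det₃)` in `S^n(ℂ^{10})`, hence (L1) in `S^n(ℂ^{n²})`,
  hence plain Koszul–Young flattenings never separate padded `perm₃` from `closure(GL·det_n)`, for any `n`.
  Scoring: HIT if the `n = 5, 6, 7` 10-variable profiles satisfy the inequality cellwise".
  Scope note (referee A1–A6 read, theory-2 2026-08-23T02:45:06Z): C-F-1 is stated in prose for all `n ≥ 3`; the
  Props typed in this file quantify `4 ≤ n` (padding exponent `n − 3 ≥ 1`). The unpadded case `n = 3` is verified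
  separately and is not part of the typed statement: over the native 9 letters
  `rank KY_{p,k}(det₃) − rank KY_{p,k}(per₃) = 16` at `(p,k) = (4,1)` and `0` at every other cell; in 10 letters it
  is `16` at `(4,1)` and `(5,1)`, `0` elsewhere (theory-2 `calc4/flat_small.py`, exact, 2026-08-23, FLAT-PLAN
  §J.10 (iv); consistent with law L6 read at `N = 10`). Hence the cellwise inequality also holds at `n = 3`, but no
  decl below asserts it.
* SCORED HIT at `n = 5, 6, 7` (2026-08-22T23:03Z, `PREDICTIONS-F-1-SCORED.md`): all 50/60/70 cells, engine `kyflat`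
  v0.2 `d03050330a46` (python stdlib, from scratch), ranks mod `2³¹−1` and `2⁶¹−1` agreeing on every cell, files
  `HOME/flat/PADDED-10var/profile_pad{perm,det}_3_{5,6,7}_10.json`; equality at every cell except exactly `(5,1)`
  and its dual `(4,n−2)`, where `det − perm = 2210 − 2194 = 16` for every `n` (the same `16 = 950 − 934` by which
  `det₃` exceeds `perm₃` at the single differing cell `(4,1)` of `S³(ℂ⁹)`, `HOME/flat/KY-CUBICS`, both certified
  exactly: unimodular minors + 184/200 exact kernel vectors).
* `n = 4`: P1 (14/14 exact values) and P2 HIT on all 64 cells of `S⁴(ℂ¹⁶)` (job j175878, 384 cells), rigorous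
  certificates `HOME/flat/NF1-CERTS-n4`, `NF1-CERTS-n5` (N-F-1 at `n = 4, 5`).
* LAW L1 (engine-3, cone decomposition; = theory-2's L3x with `Q = 1` in the extra variables):
  `rank KY_{p,k}(P ⊂ V) = Σ_j C(v − v″, p − j)·rank KY_{j,k}(P ⊂ V″)` for `P` in the variables of `V″ ⊆ V` —
  checked 100/100 cells; it makes `KYBlindPaddedPerThreeOwn → KYBlindPaddedPerThree` (positive combination), not
  formalised here.
* CLOSED FORM (theory-2 gen 4, law L6, `HOME/pub-gct-max-theory-2/F4a-CLOSEDFORM.md` sha256/16 `d508b376c0a24859`,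
  `F4aClosedForm.lean` `ee05b0111d056ea7`): derivation = L3 (KY ranks = Koszul numerics of the apolar algebra) +
  L3x (Künneth for padding and lifting) + the two 9-variable apolar Betti tables of `det₃`/`per₃` (Rowlands 2016
  Tables 6.2/6.3 = engine-3 KY-CUBICS via L3), which differ ONLY at `β_{4,6}`, `β_{5,6}` (`per − det = +16`);
  the alternating sums telescope. CHECKED against all 284 engine-3 measured cells on disk (PADDED-n4/full j175878
  @16 letters: differences 16, 96, 240, 320, … = `16·C(6,·)` in columns `k = 1, 2`; PADDED-10var `n = 4..7`:
  exactly F4's `(5,1)`, `(4,n−2)` = 16) and against L3x for `n = 4..11`, `N ∈ {n², 10, 17}`: 0 mismatches.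
* What would REFUTE S: one `(n, p, k)` with `rank KY_{p,k}(X₀₀^{n-3}per₃) > rank KY_{p,k}(X₀₀^{n-3}det₃(block))`
  (exact ranks; each instance is a finite computation); what would refute the closed form: one cell off the
  formula.

## References (statements as printed are in `HOME/typed/AS-PRINTED-2.md` §F)
* [LandsbergGCT2017] §8.2.1 eq. (8.2.1), Prop. 8.2.1.1 (Koszul–Young flattening of a polynomial; `R̲_S ≥ r/r₀`;
  (8.2.1) is a `GL(V)`-module map).
* [Farnsworth2016] Thm. 1.6 (`R̲_S(det₄) ≥ 38`), Thm. 1.8 (`R̲_S(det₃), R̲_S(perm₃) ≥ 14`), Def. 2.3 / Prop. 2.4.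
* [EfremenkoLandsbergSchenckWeyman2018] §1.1, Rem. 1.3–1.4 and the sentence after Thm. 1.5 ("it may be possible
  that a more general Young flattening is able to prove, e.g. a `ω(m²)` lower bound on `n`") — the possibility
  these located negatives speak to, for `m = 3` and the wedge family; §3 Case C1 (block restrictions of `det_n`).
* [LandsbergManivelRessayre2013] Thm. 1.0.2 (`\underline{dc}(per_m) ≥ m²/2`); [BurgisserIkenmeyerPanova2019] §1.
-/

noncomputable section

open MvPolynomial

namespace Summit.PneNP.GCT

open Literature.Computability.AlgebraicComplexity Literature.Barriers.ValiantsHypothesis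

/-! ## The 10-variable control object -/

-- WARNING (binder letters vs order, PROTOCOL §6; referee A1–A6 note): the tree writes `paddedPerPoly (n m)` and
-- `paddedDetPoly (n m)` with n = object (perm/det block) size, m = ambient size, and `ownPaddedPerPoly (m n)` with
-- m = object size, n = ambient size; this file's `ownPaddedDetPoly (m n)` follows `ownPaddedPerPoly`. All four take
-- (object size, ambient size) IN THAT ORDER under different letters. Every use here is at `(3, n)`; when citing tree
-- lemmas or generalising, match arguments by position, never by letter.

/-- The padded `m × m` determinant **on its own `m² + 1` variables** `Option (Fin m × Fin m)` (`none = z`):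
`z^{n-m} · det_m(y) ∈ S^n(ℂ ⊕ ℂ^{m×m})` — engine-3's 10-variable control object for `m = 3` (companion of the
tree's `ownPaddedPerPoly`; the `n²`-variable version is the tree's `paddedDetPoly`).
[cite: EfremenkoLandsbergSchenckWeyman2018, Conj. 1.2 (`ℓ^{n-m} perm_m` on `ℂ¹ ⊕ ℂ^{m²}`; here with `det_m`)] -/
def ownPaddedDetPoly (m n : ℕ) : MvPolynomial (Option (Fin m × Fin m)) ℂ :=
  X none ^ (n - m) * rename some (detPoly (Fin m) ℂ)

/-! ## The typed statements (definitions of `Prop`s; nothing is asserted) -/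

/-- **C-F-1 (engine-3, pre-registered 2026-08-22T22:56Z, HIT at `n = 5, 6, 7`; 10 variables):** for every
determinant size `n ≥ 4` and every `(p, k)`,
`rank KY_{p,k}(z^{n-3}·perm₃) ≤ rank KY_{p,k}(z^{n-3}·det₃)` in `S^n(ℂ ⊕ ℂ^{3×3})`.
CONJECTURE of the cell with the evidence ledger of the module docstring (exact at `n = 4,…,7`; a closed form
derived on paper by theory-2, L6); NOT a published theorem. [folklore] -/
@[conjecture]
def KYBlindPaddedPerThreeOwn : Prop :=
  ∀ n : ℕ, 4 ≤ n → ∀ p k : ℕ,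
    kyRank ℂ p k (ownPaddedPerPoly 3 n) ≤ kyRank ℂ p k (ownPaddedDetPoly 3 n)

/-- **S, the law-level statement adopted as the F-4a target (lead 2026-08-23T00:30:52Z (c); `n²` variables):**
for every determinant size `n ≥ 4` and every `(p, k)`,
`rank KY_{p,k}(X₀₀^{n-3}·per₃) ≤ rank KY_{p,k}(X₀₀^{n-3}·det₃(block))` in `S^n(ℂ^{n²})`
(tree objects `paddedPerPoly ℂ 3 n`, `paddedDetPoly ℂ 3 n`). CONJECTURE of the cell (evidence ledger and
theory-2's closed form in the module docstring), NOT a published theorem. [folklore] -/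
@[conjecture]
def KYBlindPaddedPerThree : Prop :=
  ∀ (n : ℕ) [NeZero n], 4 ≤ n → ∀ p k : ℕ,
    kyRank ℂ p k (paddedPerPoly ℂ 3 n) ≤ kyRank ℂ p k (paddedDetPoly ℂ 3 n)

/-- The correction term of theory-2's closed form (law L6):
`16 · ( [k = 1]·C(n²−10, p−5) + [k = n−2]·C(n²−10, p−4) )` (natural-number binomials; the guards `5 ≤ p`,
`4 ≤ p` make truncated subtraction harmless; at `n = 4` the two columns `k = 1`, `k = n - 2 = 2` are distinct).
[folklore] -/
def kyPaddedThreeGap (n p k : ℕ) : ℕ :=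
  16 * ((if k = 1 ∧ 5 ≤ p then Nat.choose (n ^ 2 - 10) (p - 5) else 0) +
        (if k = n - 2 ∧ 4 ≤ p then Nat.choose (n ^ 2 - 10) (p - 4) else 0))

/- Sanity values of the gap (engine-3's finding F4 and the 16-letter table at `n = 4`, `n² − 10 = 6`):
`(n,p,k) = (4,5,1) ↦ 16`, `(4,6,1) ↦ 96`, `(4,7,2) ↦ 320`, `(4,4,2) ↦ 16`, `(5,3,1) ↦ 0` — kernel-checked
below as an unnamed `example` (a named values lemma would be unreachable from every obligation node). -/
example :
    kyPaddedThreeGap 4 5 1 = 16 ∧ kyPaddedThreeGap 4 6 1 = 96 ∧ kyPaddedThreeGap 4 7 2 = 320 ∧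
      kyPaddedThreeGap 4 4 2 = 16 ∧ kyPaddedThreeGap 5 3 1 = 0 := by
  decide

/-- **Theory-2's closed form of S (law L6, 2026-08-23T01:50:28Z):** for every `n ≥ 4` and all `(p, k)`,
`rank KY_{p,k}(X₀₀^{n-3}·det₃(block)) = rank KY_{p,k}(X₀₀^{n-3}·per₃) + kyPaddedThreeGap n p k` in `S^n(ℂ^{n²})` —
an EQUALITY of Koszul–Young ranks (derivation: L3 + L3x + the two 9-variable apolar Betti tables, which differ
only at `β_{4,6}`, `β_{5,6}` by `+16`; checked on 284 measured cells and against L3x for `n = 4..11`).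
CONJECTURE/law of the cell, NOT a published theorem. [folklore] -/
@[conjecture]
def KYPaddedPerThreeClosedForm : Prop :=
  ∀ (n : ℕ) [NeZero n], 4 ≤ n → ∀ p k : ℕ,
    kyRank ℂ p k (paddedDetPoly ℂ 3 n) = kyRank ℂ p k (paddedPerPoly ℂ 3 n) + kyPaddedThreeGap n p k

/-- The implication **L6 ⇒ S** as a named statement (lead ruling 2026-08-23T03:07:14Z (1)(ii)(α): implications
between the cell's conjectures are stated as untagged `Prop`s with a `_holds` proof, so that no theorem's conclusion
is a conjecture node). [folklore] -/
def ClosedFormImpliesBlind : Prop := KYPaddedPerThreeClosedForm → KYBlindPaddedPerThree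

/-- **L6 ⇒ S holds** (one line: a natural number plus a gap is at least the number). [folklore] -/
theorem closedFormImpliesBlind_holds : ClosedFormImpliesBlind := by
  intro h n _ hn p k
  rw [h n hn p k]
  exact Nat.le_add_right _ _

/-- **N-F-1 for all `n` (the located negative S is for):** for every `n ≥ 4` and every `(p, k)`,
`rank KY_{p,k}(X₀₀^{n-3}·per₃) ≤ rank KY_{p,k}(det_n)` in `S^n(ℂ^{n²})` — no plain Koszul–Young flattening
`Λ^p ⊗ S^k` has larger rank on the padded `3 × 3` permanent than on `det_n`, so none certifies
`X₀₀^{n-3}per₃ ∉ \overline{GL_{n²}·det_n}` (tree `not_mem_orbitClosure_of_kyRank_lt` is the certificate shape;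
certified by the cell at `n = 4, 5`: `HOME/flat/NF1-CERTS-n4`, `NF1-CERTS-n5`; `n = 6, 7` at the two-prime level).
CONJECTURE/evidence statement of the cell, NOT a published theorem. [folklore] -/
@[conjecture]
def KYCannotSeparatePaddedPerThree : Prop :=
  ∀ (n : ℕ) [NeZero n], 4 ≤ n → ∀ p k : ℕ,
    kyRank ℂ p k (paddedPerPoly ℂ 3 n) ≤ kyRank ℂ p k (detPoly (Fin n) ℂ)

/-! ## Proved links -/

/-- **The control is dominated by `det_n` (a THEOREM, formerly the hypothesis `hmono`):** for every `m, n` and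
every `(p, k)`, `rank KY_{p,k}(X₀₀^{n-m}·det_m(block)) ≤ rank KY_{p,k}(det_n)`, because
`X₀₀^{n-m}·det_m(block) ∈ End(ℂ^{n²})·det_n` (tree `paddedDetPoly_mem_endOrbit_detPoly`: the block-triangular
determinant, ELSW §3 Case C1) and Koszul–Young ranks do not increase under linear substitutions (tree
`kyRank_le_of_mem_endOrbit`: Landsberg (8.2.1) is a `GL(V)`-module map + semicontinuity + `GL` dense in `End`).
[cite: EfremenkoLandsbergSchenckWeyman2018, §1.1 and Rem. 1.3–1.4] [cite: LandsbergGCT2017, §8.2.1] -/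
theorem kyRank_paddedDetPoly_le_detPoly (m n : ℕ) [NeZero n] (p k : ℕ) :
    kyRank ℂ p k (paddedDetPoly ℂ m n) ≤ kyRank ℂ p k (detPoly (Fin n) ℂ) :=
  kyRank_le_of_mem_endOrbit (paddedDetPoly_mem_endOrbit_detPoly m n) p k

/-- The implication **S ⇒ N-F-1 (all `n`)** as a named statement. [folklore] -/
def BlindImpliesCannotSeparate : Prop := KYBlindPaddedPerThree → KYCannotSeparatePaddedPerThree

/-- **S ⇒ N-F-1 holds, unconditionally**: transitivity through the control `X₀₀^{n-3}·det₃(block)`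
(`kyRank_paddedDetPoly_le_detPoly`). [folklore] -/
theorem blindImpliesCannotSeparate_holds : BlindImpliesCannotSeparate :=
  fun hS n _ hn p k => (hS n hn p k).trans (kyRank_paddedDetPoly_le_detPoly 3 n p k)

/-- The implication **L6 ⇒ N-F-1 (all `n`)** as a named statement. [folklore] -/
def ClosedFormImpliesCannotSeparate : Prop := KYPaddedPerThreeClosedForm → KYCannotSeparatePaddedPerThree

/-- **L6 ⇒ N-F-1 holds**. [folklore] -/
theorem closedFormImpliesCannotSeparate_holds : ClosedFormImpliesCannotSeparate :=
  fun h => blindImpliesCannotSeparate_holds (closedFormImpliesBlind_holds h)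

end Summit.PneNP.GCT
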